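import Literature.AlgebraicGeometry.Motives.FiberNetExistenceHolds
import Literature.AlgebraicGeometry.Motives.CurveNetFromLemma411
import HarnessLib

/-!
# Nets of `r`-folds exist — `exists_fiberNet_smoothBase_nonempty_holds`

Topic `Literature/AlgebraicGeometry/Motives`; theorems-only leaf. DISCHARGE of the named fact
`exists_fiberNet_smoothBase_nonempty` (`Motives/FiberNetExistence`: for `r ≥ 1` every smooth projective
complex `(m + r)`-fold carries a net of `r`-folds over `ℙᵐ` with non-empty smooth base; Hartshorne II
Example 7.17.3 + II Thm. 8.18, III Cor. 10.7): the induction on `r` of `Motives/FiberNetExistenceHolds`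
(`exists_fiberNet_smoothBase_nonempty_of_curveNets`, through de Jong's Lemma 4.11/4.12 for the bases
`ℙ^{m+1}`) fed with the tree's curve nets `nonempty_fiberNet_one_of_isAlgClosed`
(`Motives/CurveNetFromLemma411`, de Jong's Lemma 4.11/4.12 for `X`). Kept in its own leaf because
`FiberNetExistenceHolds` does not import `CurveNetFromLemma411`.

## References

* A. J. de Jong, *Smoothness, semi-stability and alterations*, Publ. Math. IHÉS 83 (1996),
  Lemma 4.11 and 4.12, pp. 67–69. [DeJong1996]
* R. Hartshorne, *Algebraic Geometry* (1977), II Example 7.17.3, II Thm. 8.18, III Cor. 10.7.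
  [Hartshorne1977]
-/

noncomputable section

namespace Literature.AlgebraicGeometry.Motives

/-- **Every smooth projective complex variety carries a net of `r`-folds with non-empty smooth base —
discharge of the named fact `exists_fiberNet_smoothBase_nonempty`** (Hartshorne II Example 7.17.3 with
II Thm. 8.18 and III Cor. 10.7; proved through de Jong 1996, Lemma 4.11/4.12): curve nets exist on every
smooth projective `(m + 1)`-fold over the algebraically closed `ℂ` (`nonempty_fiberNet_one_of_isAlgClosed`),
and the induction on the fibre dimension `exists_fiberNet_smoothBase_nonempty_of_curveNets` does the rest.
Relies on: nothing unproved. [cite: Hartshorne1977, II Example 7.17.3, II Thm. 8.18 and III Cor. 10.7]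
[cite: DeJong1996, Lemma 4.11 and 4.12, pp. 67–69] -/
theorem exists_fiberNet_smoothBase_nonempty_holds : exists_fiberNet_smoothBase_nonempty :=
  exists_fiberNet_smoothBase_nonempty_of_curveNets fun _ _ hX => nonempty_fiberNet_one_of_isAlgClosed hX

end Literature.AlgebraicGeometry.Motives

end
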